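import Summits.HubbardSuperconductivity.HubbardSuperconductivity.Theorems.AnisotropyChordSpinMonotoneTwoMagnonEdgeTransitive
import Summits.HubbardSuperconductivity.HubbardSuperconductivity.Theorems.AnisotropyChordSpinMonotoneTwoMagnonRookGraph

/-!
# Route `AnisotropyChord`: the two-magnon rung TM-VT on every HAMMING GRAPH `H(d, q)`
# (hypercubes, `K_q^{□ d}`; an edge-transitive family, via the one-contact-orbit theorem)

The Hamming graph on `ι → α` (`x ∼ y` iff `x` and `y` differ in exactly one coordinate; `|ι| = d`,
`|α| = q`: `H(d,q) = K_q □ ⋯ □ K_q`, `H(d,2) = Q_d` the hypercube, `H(d,3) = (ℤ/3ℤ)^d`,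
`H(2,q) = K_q □ K_q`) is connected, vertex-transitive (coordinatewise symbol permutations,
`hamming_adj_piCongrRight`) and EDGE-transitive (plus coordinate permutations,
`hamming_adj_arrowCongr`; `hamming_isEdgeTransitive`, using two-point transitivity of the symmetric
group).  Hence the one-contact-orbit theorem `twoMagnon_condensate_monotone_of_edgeTransitive` gives
the two-magnon rung TM-VT on every Hamming graph for all `Δ₁ ≤ Δ₂ ≤ 1`
(`hamming_twoMagnon_condensate_monotone`).  Products of complete graphs with UNEQUAL sides are not
edge-transitive; the two-factor case is the rook theorem (`…TwoMagnonRook`).  No definition is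
introduced.
-/

set_option linter.dupNamespace false

noncomputable section

namespace Summit.HubbardSuperconductivity.HubbardSuperconductivity.Theorems.AnisotropyChord.TwoMagnon

open Matrix Complex Finset
open Literature.MathematicalPhysics.QuantumLattice
open Literature.Combinatorics.SimpleGraph (IsVertexTransitive)
open Literature.Combinatorics.SimpleGraph.LovaszThetaEdgeTransitive (IsEdgeTransitive)

variable {ι α : Type*} [Fintype ι] [DecidableEq ι] [Fintype α] [DecidableEq α]

section Hamming

variable {G : SimpleGraph (ι → α)}

omit [Fintype ι] [DecidableEq ι] [Fintype α] [DecidableEq α] in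
/-- Coordinatewise symbol permutations are automorphisms of the Hamming graph. [folklore] -/
theorem hamming_adj_piCongrRight
    (hadj : ∀ x y : ι → α, G.Adj x y ↔ ∃ i, x i ≠ y i ∧ ∀ j, j ≠ i → x j = y j)
    (e : ι → α ≃ α) (x y : ι → α) :
    G.Adj (Equiv.piCongrRight e x) (Equiv.piCongrRight e y) ↔ G.Adj x y := by
  rw [hadj, hadj]
  simp only [Equiv.piCongrRight_apply, Pi.map_apply, ne_eq, (e _).apply_eq_iff_eq]

omit [Fintype ι] [DecidableEq ι] [Fintype α] [DecidableEq α] in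
/-- Coordinate permutations are automorphisms of the Hamming graph. [folklore] -/
theorem hamming_adj_arrowCongr
    (hadj : ∀ x y : ι → α, G.Adj x y ↔ ∃ i, x i ≠ y i ∧ ∀ j, j ≠ i → x j = y j)
    (s : ι ≃ ι) (x y : ι → α) :
    G.Adj (Equiv.arrowCongr s (Equiv.refl α) x) (Equiv.arrowCongr s (Equiv.refl α) y) ↔
      G.Adj x y := by
  rw [hadj, hadj]
  simp only [Equiv.arrowCongr_apply, Equiv.coe_refl, Function.comp_apply, id_eq, ne_eq]
  constructor
  · rintro ⟨i, hi, hrest⟩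
    refine ⟨s.symm i, hi, fun j hj => ?_⟩
    have h := hrest (s j) (fun h => hj (by rw [← h, Equiv.symm_apply_apply]))
    rwa [Equiv.symm_apply_apply] at h
  · rintro ⟨i, hi, hrest⟩
    refine ⟨s i, by rwa [Equiv.symm_apply_apply], fun j hj => ?_⟩
    exact hrest (s.symm j) (fun h => hj (by rw [← h, Equiv.apply_symm_apply]))

omit [Fintype ι] [DecidableEq ι] [Fintype α] in
/-- **The Hamming graph is vertex-transitive.** [folklore] -/
theorem hamming_isVertexTransitive
    (hadj : ∀ x y : ι → α, G.Adj x y ↔ ∃ i, x i ≠ y i ∧ ∀ j, j ≠ i → x j = y j) :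
    IsVertexTransitive G := by
  intro x y
  refine ⟨{ toEquiv := Equiv.piCongrRight fun i => Equiv.swap (x i) (y i),
            map_rel_iff' := fun {a b} => hamming_adj_piCongrRight hadj _ a b }, ?_⟩
  show Equiv.piCongrRight (fun i => Equiv.swap (x i) (y i)) x = y
  funext i
  simp only [Equiv.piCongrRight_apply, Pi.map_apply, Equiv.swap_apply_left]

omit [Fintype ι] [Fintype α] in
/-- **The Hamming graph is edge-transitive**: move the differing coordinate by a coordinate
permutation, then adjust the symbols coordinatewise (two-point transitivity of `S_q` on the differing
coordinate, transpositions elsewhere). [folklore] -/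
theorem hamming_isEdgeTransitive
    (hadj : ∀ x y : ι → α, G.Adj x y ↔ ∃ i, x i ≠ y i ∧ ∀ j, j ≠ i → x j = y j) :
    IsEdgeTransitive G := by
  intro a b c d hab hcd
  obtain ⟨i, hi, hirest⟩ := (hadj a b).1 hab
  obtain ⟨j, hj, hjrest⟩ := (hadj c d).1 hcd
  -- step 1: the coordinate permutation `swap i j`
  set s : ι ≃ ι := Equiv.swap i j with hs
  set A : (ι → α) ≃ (ι → α) := Equiv.arrowCongr s (Equiv.refl α) with hA
  have hAapp : ∀ (x : ι → α) (k : ι), A x k = x (s.symm k) := fun x k => by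
    simp only [hA, Equiv.arrowCongr_apply, Equiv.coe_refl, Function.comp_apply, id_eq]
  have hsj : s.symm j = i := by rw [hs, Equiv.symm_swap, Equiv.swap_apply_right]
  have hAaj : A a j = a i := by rw [hAapp, hsj]
  have hAbj : A b j = b i := by rw [hAapp, hsj]
  have hAab : ∀ k, k ≠ j → A a k = A b k := by
    intro k hk
    rw [hAapp, hAapp]
    apply hirest
    intro h
    apply hk
    rw [← hsj] at h
    exact s.symm.injective h
  -- step 2: the symbol permutations
  obtain ⟨ej, hej1, hej2⟩ := exists_perm_apply_pair (a := a i) (b := b i) (c := c j) (d := d j) hi hj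
  set e : ι → α ≃ α := fun k => if k = j then ej else Equiv.swap (A a k) (c k) with he
  set B : (ι → α) ≃ (ι → α) := Equiv.piCongrRight e with hB
  have hBa : B (A a) = c := by
    funext k
    simp only [hB, Equiv.piCongrRight_apply, Pi.map_apply, he]
    by_cases hk : k = j
    · subst hk
      rw [if_pos rfl, hAaj, hej1]
    · rw [if_neg hk, Equiv.swap_apply_left]
  have hBb : B (A b) = d := by
    funext k
    simp only [hB, Equiv.piCongrRight_apply, Pi.map_apply, he]
    by_cases hk : k = j
    · subst hk
      rw [if_pos rfl, hAbj, hej2]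
    · rw [if_neg hk, ← hAab k hk, Equiv.swap_apply_left]
      exact hjrest k hk
  refine ⟨{ toEquiv := A.trans B, map_rel_iff' := fun {x y} => ?_ }, Or.inl ⟨?_, ?_⟩⟩
  · show G.Adj (B (A x)) (B (A y)) ↔ G.Adj x y
    rw [hB, hamming_adj_piCongrRight hadj, hA, hamming_adj_arrowCongr hadj]
  · show B (A a) = c
    exact hBa
  · show B (A b) = d
    exact hBb

omit [Fintype α] [DecidableEq α] in
/-- **The Hamming graph is connected** (change the coordinates one at a time). [folklore] -/
theorem hamming_connected [Nonempty ι] [Nonempty α]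
    (hadj : ∀ x y : ι → α, G.Adj x y ↔ ∃ i, x i ≠ y i ∧ ∀ j, j ≠ i → x j = y j) :
    G.Connected := by
  classical
  haveI : Nonempty (ι → α) := inferInstance
  refine SimpleGraph.Connected.mk fun x y => ?_
  -- induction on a finite set of coordinates containing the disagreement set
  suffices h : ∀ (s : Finset ι) (x y : ι → α), (∀ i, i ∉ s → x i = y i) → G.Reachable x y by
    exact h Finset.univ x y (fun i hi => absurd (Finset.mem_univ i) hi)
  intro s
  induction s using Finset.induction_on with
  | empty =>
    intro x y hxy
    have : x = y := funext fun i => hxy i (by simp)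
    rw [this]
  | insert i t hit ih =>
    intro x y hxy
    -- move coordinate `i` first
    set z : ι → α := Function.update x i (y i) with hz
    have hzy : ∀ k, k ∉ t → z k = y k := by
      intro k hk
      by_cases hki : k = i
      · subst hki
        rw [hz, Function.update_self]
      · rw [hz, Function.update_of_ne hki]
        exact hxy k (by simp [hki, hk])
    have hxz : G.Reachable x z := by
      by_cases hxi : x i = y i
      · have : z = x := by
          rw [hz]
          exact Function.update_eq_self_iff.mpr hxi.symm
        rw [this]
      · refine SimpleGraph.Adj.reachable ((hadj x z).2 ⟨i, ?_, fun k hk => ?_⟩)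
        · rw [hz, Function.update_self]
          exact hxi
        · rw [hz, Function.update_of_ne hk]
    exact hxz.trans (ih z y hzy)

end Hamming

/-- **The two-magnon rung TM-VT on every Hamming graph `H(d, q)`** (`x ∼ y` iff `x, y : ι → α`
differ in exactly one coordinate; `ι`, `α` nonempty): in the sector `S^z_tot = |V|/2 − 2` of
`H(Δ) = xxzHamiltonian 1 G (−1) Δ`, for all `Δ₁ ≤ Δ₂ ≤ 1` and normalised sector ground states,
`Λ(ψ₁) ≤ Λ(ψ₂)` — an instance of `twoMagnon_condensate_monotone_of_edgeTransitive` (hypercubes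
`Q_d`, `K_q^{□ d}`). [folklore] -/
theorem hamming_twoMagnon_condensate_monotone [Nonempty ι] [Nonempty α]
    (G : SimpleGraph (ι → α)) [DecidableRel G.Adj]
    (hadj : ∀ x y : ι → α, G.Adj x y ↔ ∃ i, x i ≠ y i ∧ ∀ j, j ≠ i → x j = y j)
    {Δ₁ Δ₂ : ℝ} (h12 : Δ₁ ≤ Δ₂) (h2 : Δ₂ ≤ 1) {ψ₁ ψ₂ : ((ι → α) → Fin 2) → ℂ}
    (g₁m : ψ₁ ∈ spinZSector (Λ := ι → α) 1 ((Fintype.card (ι → α) : ℝ) / 2 - 2))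
    (g₁n : star ψ₁ ⬝ᵥ ψ₁ = 1)
    (g₁e : xxzHamiltonian 1 G (-1) Δ₁ *ᵥ ψ₁ =
      ((lowestEnergyInSector 1 (xxzHamiltonian 1 G (-1) Δ₁) ((Fintype.card (ι → α) : ℝ) / 2 - 2) : ℝ) : ℂ) • ψ₁)
    (g₂m : ψ₂ ∈ spinZSector (Λ := ι → α) 1 ((Fintype.card (ι → α) : ℝ) / 2 - 2))
    (g₂n : star ψ₂ ⬝ᵥ ψ₂ = 1)
    (g₂e : xxzHamiltonian 1 G (-1) Δ₂ *ᵥ ψ₂ =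
      ((lowestEnergyInSector 1 (xxzHamiltonian 1 G (-1) Δ₂) ((Fintype.card (ι → α) : ℝ) / 2 - 2) : ℝ) : ℂ) • ψ₂) :
    (star ψ₁ ⬝ᵥ (((∑ x, onSite x (spinRaise 1)) * (∑ y, onSite y (spinLower 1)) : Op (ι → α) 2) *ᵥ ψ₁)).re ≤
      (star ψ₂ ⬝ᵥ (((∑ x, onSite x (spinRaise 1)) * (∑ y, onSite y (spinLower 1)) : Op (ι → α) 2) *ᵥ ψ₂)).re :=
  twoMagnon_condensate_monotone_of_edgeTransitive G (hamming_connected hadj)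
    (hamming_isVertexTransitive hadj) (hamming_isEdgeTransitive hadj) h12 h2 g₁m g₁n g₁e g₂m g₂n g₂e

end Summit.HubbardSuperconductivity.HubbardSuperconductivity.Theorems.AnisotropyChord.TwoMagnon
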